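import Literature.Algebra.Homology.ScalarFilteredInfiniteCyclicExtension
import HarnessLib

/-!
# Scalar-type filtrations ascend to finite-index overgroups (averaging retraction)

Topic `Algebra/Homology`; namespace `Literature.Algebra.Homology`.  Definitions with bodies and
theorems; Mathlib + `ScalarFilteredInfiniteCyclicExtension` (pair endomorphisms of
`Coind_{Γ₀}^Γ Res V` and their Shapiro transport) + `ScalarFiltration`.

Let `Γ₀ ≤ Γ` have finite index invertible in the field `k` and `V` a representation of `Γ`.  The
**averaging retraction** `r : Coind_{Γ₀}^Γ Res V → V`, `r(f) = [Γ:Γ₀]⁻¹ ∑_{g Γ₀} g · f(g⁻¹)`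
(`average`, `averageHom`) is `Γ`-equivariant with `r ∘ ι = id` for the constant embedding
`ι : V → Coind` (`averageHom_toCoindRes`); hence `Hⁿ(ι) : Hⁿ(Γ, V) → Hⁿ(Γ, Coind) ≅ Hⁿ(Γ₀, V)` (the
restriction) is injective (`map_toCoindRes_injective`) — the transfer argument without cochain-level
transfer.  Consequently (`scalarFiltered_of_finiteIndex`): **for pair endomorphisms `(c_x, φ_x)` of
`(Γ, V)` with `c_x(Γ₀) ⊆ Γ₀`, if the pair maps on `Hⁿ(Γ₀, V)` are scalar-filtered with characters
`S` then so are the pair maps on `Hⁿ(Γ, V)`** [Brown1982CohomologyGroups, III §9–§10];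
[Harder1987, §2] (passage from the neat finite-index subgroup `Γ_U ⋊ units` to the full stabiliser).

## References

* K. S. Brown, *Cohomology of Groups*, GTM 87 (1982), III §9 (9.5), §10 (10.1)–(10.4)
  [Brown1982CohomologyGroups].
* G. Harder, *Eisenstein cohomology of arithmetic groups. The case GL₂*, Invent. Math. 89 (1987), §2
  [Harder1987].
-/

noncomputable section

open CategoryTheory groupCohomology Literature.LinearAlgebra

universe u

namespace Literature.Algebra.Homology

variable {k Γ : Type u} [Field k] [Group Γ] (Γ₀ : Subgroup Γ) (V : Rep.{u} k Γ)

/-! ### The averaging retraction -/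

/-- `g Γ₀ ↦ g · f(g⁻¹)`, well defined on `Γ ⧸ Γ₀` for `f ∈ Coind_{Γ₀}^Γ Res V`. [folklore] -/
def averageTerm (f : coindRes Γ₀ V) : Γ ⧸ Γ₀ → V :=
  Quotient.lift (fun g : Γ => V.ρ g (f.1 g⁻¹)) fun a b hab => by
    have hmem : a⁻¹ * b ∈ Γ₀ := QuotientGroup.leftRel_apply.1 hab
    have hb : b⁻¹ = ((⟨(a⁻¹ * b)⁻¹, inv_mem hmem⟩ : Γ₀) : Γ) * a⁻¹ := by
      simp [mul_inv_rev]
    change V.ρ a (f.1 a⁻¹) = V.ρ b (f.1 b⁻¹)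
    rw [hb, coindRes_apply_mul Γ₀ V f ⟨(a⁻¹ * b)⁻¹, inv_mem hmem⟩ a⁻¹, ← Module.End.mul_apply, ← map_mul]
    congr 2
    simp [mul_inv_rev]

/-- Unfolding `averageTerm` on a class. [folklore] -/
theorem averageTerm_mk (f : coindRes Γ₀ V) (g : Γ) :
    averageTerm Γ₀ V f (g : Γ ⧸ Γ₀) = V.ρ g (f.1 g⁻¹) := rfl

variable [Γ₀.FiniteIndex]

/-- A `Fintype` structure on `Γ ⧸ Γ₀`. [folklore] -/
instance fintypeQuotient : Fintype (Γ ⧸ Γ₀) := Subgroup.fintypeQuotientOfFiniteIndex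

/-- **The averaging map** `r(f) = [Γ:Γ₀]⁻¹ ∑_{g Γ₀} g · f(g⁻¹)`, as a linear map. [folklore] -/
def average : coindRes Γ₀ V →ₗ[k] V where
  toFun f := ((Γ₀.index : k))⁻¹ • ∑ q : Γ ⧸ Γ₀, averageTerm Γ₀ V f q
  map_add' f f' := by
    have hq : ∀ q, averageTerm Γ₀ V (f + f') q = averageTerm Γ₀ V f q + averageTerm Γ₀ V f' q := by
      intro q
      induction q using QuotientGroup.induction_on with
      | H g =>
        rw [averageTerm_mk, averageTerm_mk, averageTerm_mk]
        change V.ρ g ((f.1 + f'.1) g⁻¹) = _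
        rw [Pi.add_apply, map_add]
    rw [Finset.sum_congr rfl fun q _ => hq q, Finset.sum_add_distrib, smul_add]
  map_smul' r f := by
    have hq : ∀ q, averageTerm Γ₀ V (r • f) q = r • averageTerm Γ₀ V f q := by
      intro q
      induction q using QuotientGroup.induction_on with
      | H g =>
        rw [averageTerm_mk, averageTerm_mk]
        change V.ρ g ((r • f.1) g⁻¹) = _
        rw [Pi.smul_apply, map_smul]
    rw [RingHom.id_apply, Finset.sum_congr rfl fun q _ => hq q, ← Finset.smul_sum, smul_comm]

/-- Unfolding `average`. [folklore] -/
theorem average_apply (f : coindRes Γ₀ V) :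
    average Γ₀ V f = ((Γ₀.index : k))⁻¹ • ∑ q : Γ ⧸ Γ₀, averageTerm Γ₀ V f q := rfl

/-- **`r` is `Γ`-equivariant.** [cite: Brown1982CohomologyGroups, III §9] -/
theorem average_ρ (γ : Γ) (f : coindRes Γ₀ V) :
    average Γ₀ V ((coindRes Γ₀ V).ρ γ f) = V.ρ γ (average Γ₀ V f) := by
  rw [average_apply, average_apply, map_smul, map_sum]
  congr 1
  -- reindex the sum over `Γ ⧸ Γ₀` by left multiplication with `γ`
  symm
  refine Fintype.sum_equiv (MulAction.toPerm γ : Equiv.Perm (Γ ⧸ Γ₀)) _ _ fun q => ?_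
  induction q using QuotientGroup.induction_on with
  | H g =>
    rw [MulAction.toPerm_apply, MulAction.Quotient.smul_mk, smul_eq_mul, averageTerm_mk, averageTerm_mk,
      coindRes_ρ_apply, map_mul, Module.End.mul_apply, mul_inv_rev, inv_mul_cancel_right]

/-- **The averaging retraction `r : Coind_{Γ₀}^Γ Res V ⟶ V`** of representations. [folklore] -/
def averageHom : coindRes Γ₀ V ⟶ V :=
  Rep.ofHom (LinearMap.intertwiningMap_of_isIntertwiningMap _ _ (average Γ₀ V) fun γ f => average_ρ Γ₀ V γ f)

/-- Unfolding `averageHom`. [folklore] -/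
@[simp]
theorem averageHom_hom_apply (f : coindRes Γ₀ V) : (averageHom Γ₀ V).hom f = average Γ₀ V f := rfl

/-- **`r ∘ ι = id`** when the index is invertible in `k`. [cite: Brown1982CohomologyGroups, III (9.5)] -/
theorem averageHom_toCoindRes (hN : (Γ₀.index : k) ≠ 0) : toCoindRes Γ₀ V ≫ averageHom Γ₀ V = 𝟙 V := by
  refine Rep.hom_ext (Representation.IntertwiningMap.ext (LinearMap.ext fun v => ?_))
  change average Γ₀ V ((toCoindRes Γ₀ V).hom v) = v
  rw [average_apply]
  have hterm : ∀ q : Γ ⧸ Γ₀, averageTerm Γ₀ V ((toCoindRes Γ₀ V).hom v) q = v := by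
    intro q
    induction q using QuotientGroup.induction_on with
    | H g =>
      rw [averageTerm_mk]
      change V.ρ g (V.ρ g⁻¹ v) = v
      rw [← Module.End.mul_apply, ← map_mul, mul_inv_cancel, map_one, Module.End.one_apply]
  simp only [hterm, Finset.sum_const, Finset.card_univ]
  rw [← Nat.cast_smul_eq_nsmul k, smul_smul, ← Nat.card_eq_fintype_card, ← Subgroup.index_eq_card,
    inv_mul_cancel₀ hN, one_smul]

/-- **`Hⁿ(ι) : Hⁿ(Γ, V) → Hⁿ(Γ, Coind_{Γ₀}^Γ Res V)` is injective** (index invertible in `k`).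
[cite: Brown1982CohomologyGroups, III (10.3)–(10.4)] -/
theorem map_toCoindRes_injective (hN : (Γ₀.index : k) ≠ 0) (n : ℕ) :
    Function.Injective (groupCohomology.map (MonoidHom.id Γ) (toCoindRes Γ₀ V) n).hom := by
  intro a b hab
  have := congrArg (groupCohomology.map (MonoidHom.id Γ) (averageHom Γ₀ V) n).hom hab
  change (groupCohomology.map (MonoidHom.id Γ) (toCoindRes Γ₀ V) n ≫
      groupCohomology.map (MonoidHom.id Γ) (averageHom Γ₀ V) n).hom a =
    (groupCohomology.map (MonoidHom.id Γ) (toCoindRes Γ₀ V) n ≫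
      groupCohomology.map (MonoidHom.id Γ) (averageHom Γ₀ V) n).hom b at this
  rwa [← groupCohomology.map_id_comp, averageHom_toCoindRes Γ₀ V hN, groupCohomology.map_id] at this

/-! ### The ascent -/

omit [Γ₀.FiniteIndex] in
/-- `Hⁿ(ι)` commutes with the pair maps. [folklore] -/
theorem map_toCoindRes_pair {X : Type*} (c : X → (Γ →* Γ)) (hc : ∀ x, ∀ h ∈ Γ₀, c x h ∈ Γ₀)
    (φ : ∀ x, Rep.res (c x) V ⟶ V) (n : ℕ) (x : X) (v : groupCohomology V n) :
    (groupCohomology.map (MonoidHom.id Γ) (toCoindRes Γ₀ V) n).hom ((groupCohomology.map (c x) (φ x) n).hom v) =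
      (groupCohomology.map (c x) (coindPair Γ₀ V (c x) (hc x) (φ x)) n).hom
        ((groupCohomology.map (MonoidHom.id Γ) (toCoindRes Γ₀ V) n).hom v) := by
  have h : groupCohomology.map (c x) (φ x) n ≫ groupCohomology.map (MonoidHom.id Γ) (toCoindRes Γ₀ V) n =
      groupCohomology.map (MonoidHom.id Γ) (toCoindRes Γ₀ V) n ≫
        groupCohomology.map (c x) (coindPair Γ₀ V (c x) (hc x) (φ x)) n := by
    change HomologicalComplex.homologyMap (cochainsMap (c x) (φ x)) n ≫
        HomologicalComplex.homologyMap (cochainsMap (MonoidHom.id Γ) (toCoindRes Γ₀ V)) n =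
      HomologicalComplex.homologyMap (cochainsMap (MonoidHom.id Γ) (toCoindRes Γ₀ V)) n ≫
        HomologicalComplex.homologyMap (cochainsMap (c x) (coindPair Γ₀ V (c x) (hc x) (φ x))) n
    rw [← HomologicalComplex.homologyMap_comp, ← HomologicalComplex.homologyMap_comp, cochainsMap_toCoindRes_comm]
  have := congrArg (fun ψ => ψ.hom v) h
  simpa only [ModuleCat.hom_comp, LinearMap.comp_apply] using this

/-- **Scalar-type filtrations ascend to finite-index overgroups.**  Let `Γ₀ ≤ Γ` have finite index
invertible in the field `k`, `V` a representation of `Γ`, and `(c_x, φ_x)` pair endomorphisms of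
`(Γ, V)` with `c_x(Γ₀) ⊆ Γ₀`.  If the pair maps `Hⁿ(c_x|_{Γ₀}, φ_x)` on `Hⁿ(Γ₀, V)` are
scalar-filtered with characters `S`, then so are the pair maps `Hⁿ(c_x, φ_x)` on `Hⁿ(Γ, V)`.
[cite: Brown1982CohomologyGroups, III §9–§10] [cite: Harder1987, §2] -/
theorem scalarFiltered_of_finiteIndex (hN : (Γ₀.index : k) ≠ 0) {X : Type*} (c : X → (Γ →* Γ))
    (hc : ∀ x, ∀ h ∈ Γ₀, c x h ∈ Γ₀) (φ : ∀ x, Rep.res (c x) V ⟶ V) (S : Set (X → k)) (n : ℕ)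
    (h0 : ScalarFiltered
      (fun x => (groupCohomology.map (restrictEnd Γ₀ (c x) (hc x)) (resPair Γ₀ V (c x) (hc x) (φ x)) n).hom) S ⊤) :
    ScalarFiltered (fun x => (groupCohomology.map (c x) (φ x) n).hom) S ⊤ :=
  ScalarFiltered.of_injective _ (map_toCoindRes_injective Γ₀ V hN n) (map_toCoindRes_pair Γ₀ V c hc φ n)
    (scalarFiltered_coind Γ₀ V c hc φ S n h0)

end Literature.Algebra.Homology

end
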